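/-
COR-CM (cells pub-hodgecm / pub-hodgecm2, stage 2 of the Hodge ladder) — TRANSPOSITION item (vi), X3-Char ∕ Δ2 bridge supply:
THE LIU REST OF THE END DISPLAY, GENERIC IN THE CHARACTER.  The S2 END display of record (✔ p335946 «BuiltEpiD1») builds its Liu-side
datum `R := restOne (sec42DataOf h isoOf F ι₁ V Φ) … (μ := muOfInvType ι₁ Φ) …` at ONE conjugate-symplectic weight-one character per
face datum.  The Δ2 bridge at the pinned dictionary (pin-3 `Item6PlacementJunctionAppendixCAtDictionary` v4 §1∕§2; BRIDGE RECIPE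
X3-TREE-SOCKET v6 (4) ∕ v8 (4)) needs the SAME rest at EVERY `μ_i := μ_q ⊛ α_i` read off a continuous index line by X3-Char (E)
(✔ p350403 `exists_eq_chiSplittingLine_twist_weightOne_of_center_gaussianV_cm`): `R i hi := restOfChar … μ_i hμ_i hw_i` below, whose
oscillator `ω ∕ ρ` sits at the splitting family ATTACHED TO `toHeckeCharacter F μ_i` (`OmegaChiSplitting.hsChi`, the generic re-cut of
own-htheta's `OmegaMuSplitting.hsMu`).  With it, the four Liu-side READINGS the displays carried are discharged ONCE FOR ALL `μ`:
`hObj` ([Liu2021] Prop. 4.6 (1)) from [Shimura1998, Thm. 21.4] (`h21`), `hChi` (the trivial character), `hsm` (smooth vectors,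
`Def411WeilCarriers.rho_smooth`), and `hirr` ([Liu2021] Def. 4.11 «irreducible») from [Liu2021, App. D Lem. D.1 (1)] AS PRINTED per place at
the `μ`-attached local data (`hD1`), the survival clause being the THEOREM `Def411WeilCarriers.survival` (item6-p3 g9 ✔ p335094).
Seat prover-pub-hodgecm2-item6-p3-g12-0 (item6-p3 gen 12, item-(vi) lineage).  ONE data def `restOfCharD` (+ the reducible display-frame specialisation `restOfChar`) + theorems; no named fact, no
instance, no `variable` (every binder explicit, the named fact `h` included); nothing landed is edited or restated.  HC_CM is NOT proved; «Δ2 BRIDGE CLOSED» is NOT claimed; this file inhabits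
no displayed hypothesis (`h21`, `hD1` are hypotheses of its theorems) and moves no pointer.
-/
import Summits.HodgeConjecture.CorCM.B01.Transposition.Item6SupplyPinnedAssemblyAlongHoldsRestOneBuiltEpiD1
import Summits.HodgeConjecture.CorCM.B01.Transposition.Item6OmegaChiSplitting
import HarnessLib

set_option autoImplicit false

/-!
# The Liu rest at an ARBITRARY conjugate-symplectic weight-one `μ` (and an arbitrary diagonal frame), with its readings

* §D `Model.restOfCharD h F h6 ι₁ V Φ e dV hdV hdV0 ιV μ hμ hw : Thm418Rest (sec42DataOf h isoOf F ι₁ V Φ)` — `restOne` over the constructed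
  §4.2 datum with the Def. 4.5 carriers `Carriers.ofPolDR μ (PolDR ι₁ hμ (RMuForm ι₁ hμ))`, the Def. 4.11 carriers `Eps ∕ epsOf ∕ Chi ∕ omega ∕ rho`
  at the `toHeckeCharacter F μ`-attached splitting family over the frame `(e, dV)` (`OmegaChiSplitting.hsChiD`) pulled back along
  `ιV : (sec42DataOf …).G →* U(diag dV)(𝔸_{F⁺,f})`, and the Hecke action `rhoΩOne` of `heckeTranslatesFamilyOf … h6`; readings
  `nonempty_obj_restOfCharD (h21)` ([Liu2021] Prop. 4.6 (1) from [Shimura1998] Thm. 21.4), `nonempty_chi_restOfCharD`,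
  `rhoAt_restOfCharD_smooth (hιc)` (`rho_smooth`), `rhoAt_restOfCharD_isIrreducible_of_lemD1AsPrinted (hιs) (hn) (hD1)` (Def. 4.11 «irreducible»
  from Lem. D.1 (1) AS PRINTED at the `μ`-attached local data, `hfac := OmegaChiSplitting.hfac_sChiD`, survival = the THEOREM
  `Def411WeilCarriers.survival`) and `nontrivial_omegaAt_restOfCharD_of_lemD1AsPrinted` (the Δ2 junction's `hnvD` shape);
* §V `Model.restOfChar h F h6 ι₁ V Φ μ hμ hw` — the display frame `(finProdFinEquiv, V.diagEntries, V.adelicFinDiag)`: the pointer-#7 R-term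
  VERBATIM with `muOfInvType ι₁ Φ ↦ μ`; `nonempty_obj_restOfChar`, `nonempty_chi_restOfChar`, `rhoAt_restOfChar_smooth`,
  `rhoAt_restOfChar_isIrreducible_of_lemD1AsPrinted`.

HC_CM is NOT proved.
-/

noncomputable section

open scoped TensorProduct InnerProductSpace Kronecker Matrix

namespace Summit.HodgeConjecture.CorCM.Model

open CategoryTheory CategoryTheory.Limits AlgebraicGeometry NumberField IsDedekindDomain
open Literature.AlgebraicGeometry.Motives
open Literature.AlgebraicGeometry.HodgeTheory
open Literature.AlgebraicGeometry.ShimuraVarieties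
open Literature.AlgebraicGeometry.ShimuraVarieties.UnitaryCanonicalModel
open Literature.AlgebraicGeometry.ComplexMultiplication (IsCMTypeRealisation)
open Literature.NumberTheory.ComplexMultiplication
open Literature.NumberTheory.Automorphic
open Literature.NumberTheory.Automorphic.UnitaryGroup (localCharOfCenter)
open Literature.NumberTheory.Automorphic.IdeleClassGroup
open Literature.NumberTheory.Automorphic.PicardCM
open Literature.NumberTheory.Automorphic.Liu2021
open Literature.NumberTheory.Automorphic.Liu2021.AppendixC
open Literature.NumberTheory.Automorphic.Liu2021.AppendixC.RestOne
open Literature.NumberTheory.Automorphic.Liu2021.Def411WeilCarriers (JW TW isSymm_TW isUnit_det_TW JW_eq JW_apply_ne_zero lineOf)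
open Literature.NumberTheory.GelbartRogawski1991 Literature.NumberTheory.GelbartRogawski1991.UnitaryDualPair
open Literature.NumberTheory.GelbartRogawski1991.UnitaryDualPair.WeilCoinv
open Literature.NumberTheory.GelbartRogawski1991.UnitaryDualPair.LocalSplitting (localMu norm_localMu continuous_localMu localMu_toLocalRing_eq_one_iff)
open Literature.NumberTheory.Weil1964 Literature.RepresentationTheory
open Literature.RepresentationTheory.Liu2021
open Summit.HodgeConjecture.CorCM.Transposition

/-! ## §D The rest at an arbitrary `μ`, over an arbitrary diagonal frame `(e, dV)` with group identification `ιV` -/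

section Frame

set_option maxHeartbeats 1000000 in
-- (one `restOne` application whose ω-arguments carry the `splittingDatum` telescope; the same term as the display's, at a variable `μ`)
/-- **The Liu rest, GENERIC in `μ` and in the frame.**  For `F/ℚ` Galois with `6 ≤ [F:ℚ]`, a face datum `(ι₁, V, Φ)`, a real non-degenerate
diagonal frame `(e, dV)` of rank `3` with an identification `ιV : 𝔾(𝔸_F^∞) = (sec42DataOf …).G →* U(diag dV)(𝔸_{F⁺,f})` (display:
`(finProdFinEquiv, V.diagEntries, V.adelicFinDiag)`; pinned dictionary: the ported `(e₁, frameD V, ιVE V)`), and ANY conjugate-symplectic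
weight-one `μ` (`hμ`, `hw`): the ONE-OBJECT rest `restOne` ([Liu2021] Def. 4.5 (2) ∕ 4.11 ∕ 4.16, `Liu2021/AppendixC/RestOne`) over the constructed
§4.2 datum `sec42DataOf h isoOf F ι₁ V Φ`, with Def. 4.5 carriers `Carriers.ofPolDR μ (PolDR ι₁ hμ (RMuForm ι₁ hμ))`, Def. 4.11 carriers
`Eps ∕ epsOf ∕ Chi` and the oscillator `omega ∕ rho` at the splitting family `OmegaChiSplitting.sChiD … (toHeckeCharacter F μ) …` ATTACHED TO `μ`
([GR91] Prop. 3.1.1; [Liu2021] App. D Step 2) pulled back along `ιV`, and the Hecke action `rhoΩOne` of the constructed translates.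
[cite: Liu2021, Def. 4.5 (2) (FJcycle.tex l. 1944–1958), Def. 4.11 (l. 2090–2096), Def. 4.16 (l. 2219), App. D §D.1 Step 2 (l. 5219)]
[cite: GelbartRogawski1991, §3.1 Prop. 3.1.1 p. 455 L1–3] -/
def restOfCharD (h : exists_recordSystem) (F : CMField) [IsGalois ℚ F] (h6 : 6 ≤ Module.finrank ℚ F)
    (ι₁ : F →+* ℂ) (V : HermSpace3 F ι₁) (Φ : CMType F) {n : ℕ} (e : Fin 3 × Fin 1 ≃ Fin n) (dV : Fin 3 → F)
    (hdV : ∀ i, IsCMField.complexConj F (dV i) = dV i) (hdV0 : ∀ i, dV i ≠ 0)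
    (ιV : (sec42DataOf h isoOf F ι₁ V Φ).G →*
      UnitaryGroup.finAdelic ↥(maximalRealSubfield F) F (IsCMField.complexConj F) 3 (Matrix.diagonal dV))
    (μ : IdeleClassGroup F →ₜ* Circle) (hμ : IdeleClassGroup.IsConjugateSymplectic F μ) (hw : IdeleClassGroup.HasWeight F μ 1) :
    Thm418Rest (sec42DataOf h isoOf F ι₁ V Φ) :=
  restOne (sec42DataOf h isoOf F ι₁ V Φ) (AlgHom.id ℚ F) ι₁ hμ hw
    (Def45.Carriers.ofPolDR μ (Def45.PolDR ι₁ hμ (Def45.RMuForm ι₁ hμ)))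
    (Def411WeilCarriers.Eps ↥(maximalRealSubfield F) (imagUnitSq F))
    (Def411WeilCarriers.epsOf ↥(maximalRealSubfield F) (imagUnitSq F) F (imagUnit F))
    (Def411WeilCarriers.Chi ↥(maximalRealSubfield F) F (IsCMField.complexConj F))
    (Def411WeilCarriers.omega ↥(maximalRealSubfield F) F (IsCMField.complexConj F) 3 e (Matrix.diagonal dV)
      (complexConj_imagUnit F) (imagUnit_ne_zero F) (imagUnit_mul_self F) (realDiagonal_isSymm F dV hdV)
      (isUnit_det_realDiagonal F dV hdV hdV0) (realDiagonal_map F dV hdV).symm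
      (OmegaChiSplitting.hsChiD F e dV hdV hdV0 (toHeckeCharacter F μ) (isUnitary_toHeckeCharacter F μ)
        ((isOscillatorChar_toHeckeCharacter_iff μ).mpr hμ)))
    (Def411WeilCarriers.rho ↥(maximalRealSubfield F) F (IsCMField.complexConj F) 3 e (Matrix.diagonal dV)
      (complexConj_imagUnit F) (imagUnit_ne_zero F) (imagUnit_mul_self F) (realDiagonal_isSymm F dV hdV)
      (isUnit_det_realDiagonal F dV hdV hdV0) (realDiagonal_map F dV hdV).symm
      (OmegaChiSplitting.hsChiD F e dV hdV hdV0 (toHeckeCharacter F μ) (isUnitary_toHeckeCharacter F μ)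
        ((isOscillatorChar_toHeckeCharacter_iff μ).mpr hμ))
      ιV)
    ((heckeTranslatesFamilyOf heckeTranslate_definedOver_holds h isoOf F ι₁ V Φ h6).rhoΩOne (AlgHom.id ℚ F) ι₁ hμ hw
      (Def45.Carriers.ofPolDR μ (Def45.PolDR ι₁ hμ (Def45.RMuForm ι₁ hμ))))

/-- **`𝒜(μ) ≠ ∅` at the generic rest** ([Liu2021] Prop. 4.6 (1) «nonempty»), from [Shimura1998, Thm. 21.4] (Casselman) entered as the
hypothesis `h21`: `nonempty_obj_restOne_iff` + `Def45.nonempty_cmDatum_polDR_rMuForm_of_casselman` (pin-2 ∕ b25 lineage, generic in `μ`).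
[cite: Liu2021, Prop. 4.6 (1) (FJcycle.tex l. 1969; proof l. 1975–1984)] [cite: Shimura1998, §21.4 Thm. 21.4] -/
theorem nonempty_obj_restOfCharD (h : exists_recordSystem) (F : CMField) [IsGalois ℚ F] (h6 : 6 ≤ Module.finrank ℚ F)
    (ι₁ : F →+* ℂ) (V : HermSpace3 F ι₁) (Φ : CMType F) {n : ℕ} (e : Fin 3 × Fin 1 ≃ Fin n) (dV : Fin 3 → F)
    (hdV : ∀ i, IsCMField.complexConj F (dV i) = dV i) (hdV0 : ∀ i, dV i ≠ 0)
    (ιV : (sec42DataOf h isoOf F ι₁ V Φ).G →*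
      UnitaryGroup.finAdelic ↥(maximalRealSubfield F) F (IsCMField.complexConj F) 3 (Matrix.diagonal dV))
    (μ : IdeleClassGroup F →ₜ* Circle) (hμ : IdeleClassGroup.IsConjugateSymplectic F μ) (hw : IdeleClassGroup.HasWeight F μ 1)
    (h21 : shimura1998_thm21_4_casselman) :
    Nonempty (toThm418Data (sec42DataOf h isoOf F ι₁ V Φ) (restOfCharD h F h6 ι₁ V Φ e dV hdV hdV0 ιV μ hμ hw)).Obj := by
  unfold restOfCharD
  exact (nonempty_obj_restOne_iff _ _ _ _ _ _ _ _ _ _ _ _).mpr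
    (Def45.nonempty_cmDatum_polDR_rMuForm_of_casselman (σ := ι₁) (hμ := hμ) hw h21)

/-- **a character `χ` exists at the generic rest** ([Liu2021] Def. 4.11 third bullet: the trivial character; `Def411WeilCarriers.nonempty_chi`).
[cite: Liu2021, Def. 4.11 (FJcycle.tex l. 2090)] -/
theorem nonempty_chi_restOfCharD (h : exists_recordSystem) (F : CMField) [IsGalois ℚ F] (h6 : 6 ≤ Module.finrank ℚ F)
    (ι₁ : F →+* ℂ) (V : HermSpace3 F ι₁) (Φ : CMType F) {n : ℕ} (e : Fin 3 × Fin 1 ≃ Fin n) (dV : Fin 3 → F)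
    (hdV : ∀ i, IsCMField.complexConj F (dV i) = dV i) (hdV0 : ∀ i, dV i ≠ 0)
    (ιV : (sec42DataOf h isoOf F ι₁ V Φ).G →*
      UnitaryGroup.finAdelic ↥(maximalRealSubfield F) F (IsCMField.complexConj F) 3 (Matrix.diagonal dV))
    (μ : IdeleClassGroup F →ₜ* Circle) (hμ : IdeleClassGroup.IsConjugateSymplectic F μ) (hw : IdeleClassGroup.HasWeight F μ 1) :
    Nonempty (toThm418Data (sec42DataOf h isoOf F ι₁ V Φ) (restOfCharD h F h6 ι₁ V Φ e dV hdV hdV0 ιV μ hμ hw)).Chi :=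
  Def411WeilCarriers.nonempty_chi ↥(maximalRealSubfield F) F (IsCMField.complexConj F)

/-- **`ω(μ, ε, χ)` is smooth at the generic rest** ([Liu2021] Def. 4.11 «irreducible admissible»: every vector is fixed by an open subgroup of
`𝔾(𝔸_F^∞)`) — `Def411WeilCarriers.rho_smooth` at the `μ`-attached splitting family (`OmegaChiSplitting.hscChiD`) through a CONTINUOUS `ιV`.
[cite: Liu2021, Def. 4.11 (FJcycle.tex l. 2094–2096)] [cite: GelbartRogawski1991, §3.1 Prop. 3.1.1 p. 455 L1–3] -/
theorem rhoAt_restOfCharD_smooth (h : exists_recordSystem) (F : CMField) [IsGalois ℚ F] (h6 : 6 ≤ Module.finrank ℚ F)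
    (ι₁ : F →+* ℂ) (V : HermSpace3 F ι₁) (Φ : CMType F) {n : ℕ} (e : Fin 3 × Fin 1 ≃ Fin n) (dV : Fin 3 → F)
    (hdV : ∀ i, IsCMField.complexConj F (dV i) = dV i) (hdV0 : ∀ i, dV i ≠ 0)
    (ιV : (sec42DataOf h isoOf F ι₁ V Φ).G →*
      UnitaryGroup.finAdelic ↥(maximalRealSubfield F) F (IsCMField.complexConj F) 3 (Matrix.diagonal dV))
    (μ : IdeleClassGroup F →ₜ* Circle) (hμ : IdeleClassGroup.IsConjugateSymplectic F μ) (hw : IdeleClassGroup.HasWeight F μ 1) (hιc : Continuous ιV)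
    (i : (toThm418Data (sec42DataOf h isoOf F ι₁ V Φ) (restOfCharD h F h6 ι₁ V Φ e dV hdV hdV0 ιV μ hμ hw)).AdmIndex)
    (v : (toThm418Data (sec42DataOf h isoOf F ι₁ V Φ) (restOfCharD h F h6 ι₁ V Φ e dV hdV hdV0 ιV μ hμ hw)).omegaAt i) :
    ∃ S : Subgroup (sec42DataOf h isoOf F ι₁ V Φ).G, IsOpen (S : Set (sec42DataOf h isoOf F ι₁ V Φ).G) ∧
      ∀ k ∈ S, (toThm418Data (sec42DataOf h isoOf F ι₁ V Φ) (restOfCharD h F h6 ι₁ V Φ e dV hdV hdV0 ιV μ hμ hw)).rhoAt i k v = v :=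
  Def411WeilCarriers.rho_smooth ↥(maximalRealSubfield F) F (IsCMField.complexConj F) 3 e (Matrix.diagonal dV)
    (complexConj_imagUnit F) (imagUnit_ne_zero F) (imagUnit_mul_self F) (realDiagonal_isSymm F dV hdV)
    (isUnit_det_realDiagonal F dV hdV hdV0) (realDiagonal_map F dV hdV).symm
    (OmegaChiSplitting.hsChiD F e dV hdV hdV0 (toHeckeCharacter F μ) (isUnitary_toHeckeCharacter F μ)
      ((isOscillatorChar_toHeckeCharacter_iff μ).mpr hμ))
    ιV hιc
    (OmegaChiSplitting.hscChiD F e dV hdV hdV0 (toHeckeCharacter F μ) (isUnitary_toHeckeCharacter F μ)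
      ((isOscillatorChar_toHeckeCharacter_iff μ).mpr hμ)) i.1.1 i.1.2 v

/-- **`ω(μ, ε, χ)` is irreducible at the generic rest, from [Liu2021, App. D Lemma D.1 (1)] AS PRINTED per place** (the displays' `hirr ↦ hD1`
swap, once for all `μ` and every frame): for an admissible index `i = (ε, χ)`, a SURJECTIVE `ιV` and `3 ≤ n`, GIVEN the cite `hD1 v` = Lemma D.1
(first sentence + (1)) for the local datum `localLemD1Data … (lineOf ε) (chiLocalSplittingsD … (lineOf ε)) … (localMu F (toHeckeCharacter F μ)) … χ v`
at EVERY finite place `v` — the `μ`-attached local splittings ([GR91] Prop. 3.1.1 place by place) and [Liu2021] App. D Step 2's local characters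
`μ_v := localMu F (toHeckeCharacter F μ) v` with their three printed properties PROVED (GR-1 `CMSplittingCharLocalMu`) — the representation
`rhoAt i` of the rest IS IRREDUCIBLE: `Def411WeilCarriers.rho_isIrreducible_of_lemD1AsPrinted` with the local–global factorisation
`hfac := OmegaChiSplitting.hfac_sChiD` and Def. 4.11's `⊗'` survival clause DISCHARGED by the theorem `Def411WeilCarriers.survival`.
Nothing of [Liu2021] is asserted: `hD1` is a hypothesis.
[cite: Liu2021, Def. 4.11 (FJcycle.tex l. 2090–2096), App. D §D.1 Steps 1∕2∕3 (l. 5217∕5219∕5221), Lemma D.1 (l. 5227; (1) l. 5229)]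
[cite: GelbartRogawski1991, §3.1 Prop. 3.1.1 p. 455 L1–3, Remark p. 457 L4–13] -/
theorem rhoAt_restOfCharD_isIrreducible_of_lemD1AsPrinted (h : exists_recordSystem) (F : CMField) [IsGalois ℚ F] (h6 : 6 ≤ Module.finrank ℚ F)
    (ι₁ : F →+* ℂ) (V : HermSpace3 F ι₁) (Φ : CMType F) {n : ℕ} (e : Fin 3 × Fin 1 ≃ Fin n) (dV : Fin 3 → F)
    (hdV : ∀ i, IsCMField.complexConj F (dV i) = dV i) (hdV0 : ∀ i, dV i ≠ 0)
    (ιV : (sec42DataOf h isoOf F ι₁ V Φ).G →*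
      UnitaryGroup.finAdelic ↥(maximalRealSubfield F) F (IsCMField.complexConj F) 3 (Matrix.diagonal dV))
    (μ : IdeleClassGroup F →ₜ* Circle) (hμ : IdeleClassGroup.IsConjugateSymplectic F μ) (hw : IdeleClassGroup.HasWeight F μ 1)
    (hιs : Function.Surjective ιV) (hn : 3 ≤ n)
    (i : (toThm418Data (sec42DataOf h isoOf F ι₁ V Φ) (restOfCharD h F h6 ι₁ V Φ e dV hdV hdV0 ιV μ hμ hw)).AdmIndex)
    (hD1 : ∀ v : HeightOneSpectrum (𝓞 ↥(maximalRealSubfield F)), LemD1_1AsPrinted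
      (Def411WeilCarriers.localLemD1Data ↥(maximalRealSubfield F) F (IsCMField.complexConj F) 3 e (Matrix.diagonal dV)
        (complexConj_imagUnit F) (imagUnit_ne_zero F) (imagUnit_mul_self F) (realDiagonal_isSymm F dV hdV)
        (isUnit_det_realDiagonal F dV hdV hdV0) (realDiagonal_map F dV hdV).symm (lineOf ↥(maximalRealSubfield F) (imagUnitSq F) i.1.1)
        (OmegaChiSplitting.chiLocalSplittingsD F e dV hdV hdV0 (toHeckeCharacter F μ) ((isOscillatorChar_toHeckeCharacter_iff μ).mpr hμ)
          (lineOf ↥(maximalRealSubfield F) (imagUnitSq F) i.1.1))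
        hn (localMu F (toHeckeCharacter F μ))
        (fun v x => norm_localMu F (toHeckeCharacter F μ) v (isUnitary_toHeckeCharacter F μ) x)
        (continuous_localMu F (toHeckeCharacter F μ))
        (fun v t => localMu_toLocalRing_eq_one_iff F (toHeckeCharacter F μ) v ((isOscillatorChar_toHeckeCharacter_iff μ).mpr hμ) t)
        i.1.2.1
        (Def411WeilCarriers.norm_chi_eq_one ↥(maximalRealSubfield F) F (IsCMField.complexConj F)
          (Algebra.IsQuadraticExtension.finrank_eq_two ↥(maximalRealSubfield F) F)
          (UnitaryGroup.algEquiv_ne_one_of_apply_eq_neg ↥(maximalRealSubfield F) F (IsCMField.complexConj F) (complexConj_imagUnit F)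
            (imagUnit_ne_zero F)) i.1.2)
        i.1.2.2.1 v)) :
    ((toThm418Data (sec42DataOf h isoOf F ι₁ V Φ) (restOfCharD h F h6 ι₁ V Φ e dV hdV hdV0 ιV μ hμ hw)).rhoAt i).IsIrreducible :=
  haveI : NeZero n := ⟨by omega⟩
  Def411WeilCarriers.rho_isIrreducible_of_lemD1AsPrinted ↥(maximalRealSubfield F) F (IsCMField.complexConj F) 3 e
    (Matrix.diagonal dV) (complexConj_imagUnit F) (imagUnit_ne_zero F) (imagUnit_mul_self F) (realDiagonal_isSymm F dV hdV)
    (isUnit_det_realDiagonal F dV hdV hdV0) (realDiagonal_map F dV hdV).symm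
    (OmegaChiSplitting.hsChiD F e dV hdV hdV0 (toHeckeCharacter F μ) (isUnitary_toHeckeCharacter F μ)
      ((isOscillatorChar_toHeckeCharacter_iff μ).mpr hμ))
    i.1.1 i.1.2
    (OmegaChiSplitting.chiLocalSplittingsD F e dV hdV hdV0 (toHeckeCharacter F μ) ((isOscillatorChar_toHeckeCharacter_iff μ).mpr hμ)
      (lineOf ↥(maximalRealSubfield F) (imagUnitSq F) i.1.1))
    (ι := ιV) hιs
    (OmegaChiSplitting.hfac_sChiD F e dV hdV hdV0 (toHeckeCharacter F μ) (isUnitary_toHeckeCharacter F μ)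
      ((isOscillatorChar_toHeckeCharacter_iff μ).mpr hμ) (lineOf ↥(maximalRealSubfield F) (imagUnitSq F) i.1.1))
    hn (localMu F (toHeckeCharacter F μ))
    (fun v x => norm_localMu F (toHeckeCharacter F μ) v (isUnitary_toHeckeCharacter F μ) x)
    (continuous_localMu F (toHeckeCharacter F μ))
    (fun v t => localMu_toLocalRing_eq_one_iff F (toHeckeCharacter F μ) v ((isOscillatorChar_toHeckeCharacter_iff μ).mpr hμ) t)
    hD1
    (Def411WeilCarriers.survival ↥(maximalRealSubfield F) F (IsCMField.complexConj F) 3 e (Matrix.diagonal dV)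
      (complexConj_imagUnit F) (imagUnit_ne_zero F) (imagUnit_mul_self F) (realDiagonal_isSymm F dV hdV)
      (isUnit_det_realDiagonal F dV hdV hdV0) (realDiagonal_map F dV hdV).symm i.1.1 i.1.2
      (OmegaChiSplitting.chiLocalSplittingsD F e dV hdV hdV0 (toHeckeCharacter F μ) ((isOscillatorChar_toHeckeCharacter_iff μ).mpr hμ)
        (lineOf ↥(maximalRealSubfield F) (imagUnitSq F) i.1.1)))

/-- **`ω(μ, ε, χ) ≠ 0` at the generic rest** — the Δ2 junction's `hnvD` binder shape — from the irreducibility just derived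
(`Representation.IsIrreducible.nontrivial`; [Liu2021] App. D Lem. D.1 (1) «non-zero» per place, hypothesis `hD1`).
[cite: Liu2021, Def. 4.11 (FJcycle.tex l. 2094–2096), App. D Lemma D.1 (1) (l. 5229)] -/
theorem nontrivial_omegaAt_restOfCharD_of_lemD1AsPrinted (h : exists_recordSystem) (F : CMField) [IsGalois ℚ F] (h6 : 6 ≤ Module.finrank ℚ F)
    (ι₁ : F →+* ℂ) (V : HermSpace3 F ι₁) (Φ : CMType F) {n : ℕ} (e : Fin 3 × Fin 1 ≃ Fin n) (dV : Fin 3 → F)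
    (hdV : ∀ i, IsCMField.complexConj F (dV i) = dV i) (hdV0 : ∀ i, dV i ≠ 0)
    (ιV : (sec42DataOf h isoOf F ι₁ V Φ).G →*
      UnitaryGroup.finAdelic ↥(maximalRealSubfield F) F (IsCMField.complexConj F) 3 (Matrix.diagonal dV))
    (μ : IdeleClassGroup F →ₜ* Circle) (hμ : IdeleClassGroup.IsConjugateSymplectic F μ) (hw : IdeleClassGroup.HasWeight F μ 1)
    (hιs : Function.Surjective ιV) (hn : 3 ≤ n)
    (i : (toThm418Data (sec42DataOf h isoOf F ι₁ V Φ) (restOfCharD h F h6 ι₁ V Φ e dV hdV hdV0 ιV μ hμ hw)).AdmIndex)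
    (hD1 : ∀ v : HeightOneSpectrum (𝓞 ↥(maximalRealSubfield F)), LemD1_1AsPrinted
      (Def411WeilCarriers.localLemD1Data ↥(maximalRealSubfield F) F (IsCMField.complexConj F) 3 e (Matrix.diagonal dV)
        (complexConj_imagUnit F) (imagUnit_ne_zero F) (imagUnit_mul_self F) (realDiagonal_isSymm F dV hdV)
        (isUnit_det_realDiagonal F dV hdV hdV0) (realDiagonal_map F dV hdV).symm (lineOf ↥(maximalRealSubfield F) (imagUnitSq F) i.1.1)
        (OmegaChiSplitting.chiLocalSplittingsD F e dV hdV hdV0 (toHeckeCharacter F μ) ((isOscillatorChar_toHeckeCharacter_iff μ).mpr hμ)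
          (lineOf ↥(maximalRealSubfield F) (imagUnitSq F) i.1.1))
        hn (localMu F (toHeckeCharacter F μ))
        (fun v x => norm_localMu F (toHeckeCharacter F μ) v (isUnitary_toHeckeCharacter F μ) x)
        (continuous_localMu F (toHeckeCharacter F μ))
        (fun v t => localMu_toLocalRing_eq_one_iff F (toHeckeCharacter F μ) v ((isOscillatorChar_toHeckeCharacter_iff μ).mpr hμ) t)
        i.1.2.1
        (Def411WeilCarriers.norm_chi_eq_one ↥(maximalRealSubfield F) F (IsCMField.complexConj F)
          (Algebra.IsQuadraticExtension.finrank_eq_two ↥(maximalRealSubfield F) F)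
          (UnitaryGroup.algEquiv_ne_one_of_apply_eq_neg ↥(maximalRealSubfield F) F (IsCMField.complexConj F) (complexConj_imagUnit F)
            (imagUnit_ne_zero F)) i.1.2)
        i.1.2.2.1 v)) :
    Nontrivial ((toThm418Data (sec42DataOf h isoOf F ι₁ V Φ) (restOfCharD h F h6 ι₁ V Φ e dV hdV hdV0 ιV μ hμ hw)).omegaAt i) :=
  haveI := rhoAt_restOfCharD_isIrreducible_of_lemD1AsPrinted h F h6 ι₁ V Φ e dV hdV hdV0 ιV μ hμ hw hιs hn i hD1
  Representation.IsIrreducible.nontrivial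
    ((toThm418Data (sec42DataOf h isoOf F ι₁ V Φ) (restOfCharD h F h6 ι₁ V Φ e dV hdV hdV0 ιV μ hμ hw)).rhoAt i)

end Frame

/-! ## §V The display frame `(finProdFinEquiv, V.diagEntries, V.adelicFinDiag)` -/

section Display

/-- **The Liu rest of the END display, GENERIC in `μ`**: `restOfCharD` at the display's own frame `(finProdFinEquiv, V.diagEntries)` and group
identification `V.adelicFinDiag` — the pointer-#7 R-term VERBATIM with `muOfInvType ι₁ Φ ↦ μ` (and the base character `chiMu F ι₁ Φ ↦
toHeckeCharacter F μ`; at `μ := muOfInvType ι₁ Φ` the two agree up to the propositional `OmegaMuSplitting.chiMu_eq`, which no consumer of this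
file needs). [cite: Liu2021, Def. 4.5 (2) (FJcycle.tex l. 1944–1958), Def. 4.11 (l. 2090–2096), Def. 4.16 (l. 2219)] -/
abbrev restOfChar (h : exists_recordSystem) (F : CMField) [IsGalois ℚ F] (h6 : 6 ≤ Module.finrank ℚ F)
    (ι₁ : F →+* ℂ) (V : HermSpace3 F ι₁) (Φ : CMType F) (μ : IdeleClassGroup F →ₜ* Circle)
    (hμ : IdeleClassGroup.IsConjugateSymplectic F μ) (hw : IdeleClassGroup.HasWeight F μ 1) :
    Thm418Rest (sec42DataOf h isoOf F ι₁ V Φ) :=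
  restOfCharD h F h6 ι₁ V Φ finProdFinEquiv V.diagEntries V.complexConj_diagEntries V.diagEntries_ne_zero
    V.adelicFinDiag.toMulEquiv.toMonoidHom μ hμ hw

/-- `𝒜(μ) ≠ ∅` at `restOfChar`, from `h21`. [cite: Liu2021, Prop. 4.6 (1) (FJcycle.tex l. 1969)] [cite: Shimura1998, §21.4 Thm. 21.4] -/
theorem nonempty_obj_restOfChar (h : exists_recordSystem) (F : CMField) [IsGalois ℚ F] (h6 : 6 ≤ Module.finrank ℚ F)
    (ι₁ : F →+* ℂ) (V : HermSpace3 F ι₁) (Φ : CMType F) (μ : IdeleClassGroup F →ₜ* Circle)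
    (hμ : IdeleClassGroup.IsConjugateSymplectic F μ) (hw : IdeleClassGroup.HasWeight F μ 1)
    (h21 : shimura1998_thm21_4_casselman) :
    Nonempty (toThm418Data (sec42DataOf h isoOf F ι₁ V Φ) (restOfChar h F h6 ι₁ V Φ μ hμ hw)).Obj :=
  nonempty_obj_restOfCharD h F h6 ι₁ V Φ _ _ _ _ _ μ hμ hw h21

/-- a character exists at `restOfChar`. [cite: Liu2021, Def. 4.11 (FJcycle.tex l. 2090)] -/
theorem nonempty_chi_restOfChar (h : exists_recordSystem) (F : CMField) [IsGalois ℚ F] (h6 : 6 ≤ Module.finrank ℚ F)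
    (ι₁ : F →+* ℂ) (V : HermSpace3 F ι₁) (Φ : CMType F) (μ : IdeleClassGroup F →ₜ* Circle)
    (hμ : IdeleClassGroup.IsConjugateSymplectic F μ) (hw : IdeleClassGroup.HasWeight F μ 1) :
    Nonempty (toThm418Data (sec42DataOf h isoOf F ι₁ V Φ) (restOfChar h F h6 ι₁ V Φ μ hμ hw)).Chi :=
  nonempty_chi_restOfCharD h F h6 ι₁ V Φ _ _ _ _ _ μ hμ hw

/-- `ω(μ, ε, χ)` is smooth at `restOfChar` (`V.adelicFinDiag` is continuous). [cite: Liu2021, Def. 4.11 (FJcycle.tex l. 2094–2096)] -/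
theorem rhoAt_restOfChar_smooth (h : exists_recordSystem) (F : CMField) [IsGalois ℚ F] (h6 : 6 ≤ Module.finrank ℚ F)
    (ι₁ : F →+* ℂ) (V : HermSpace3 F ι₁) (Φ : CMType F) (μ : IdeleClassGroup F →ₜ* Circle)
    (hμ : IdeleClassGroup.IsConjugateSymplectic F μ) (hw : IdeleClassGroup.HasWeight F μ 1)
    (i : (toThm418Data (sec42DataOf h isoOf F ι₁ V Φ) (restOfChar h F h6 ι₁ V Φ μ hμ hw)).AdmIndex)
    (v : (toThm418Data (sec42DataOf h isoOf F ι₁ V Φ) (restOfChar h F h6 ι₁ V Φ μ hμ hw)).omegaAt i) :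
    ∃ S : Subgroup (sec42DataOf h isoOf F ι₁ V Φ).G, IsOpen (S : Set (sec42DataOf h isoOf F ι₁ V Φ).G) ∧
      ∀ k ∈ S, (toThm418Data (sec42DataOf h isoOf F ι₁ V Φ) (restOfChar h F h6 ι₁ V Φ μ hμ hw)).rhoAt i k v = v :=
  rhoAt_restOfCharD_smooth h F h6 ι₁ V Φ _ _ _ _ _ μ hμ hw V.continuous_adelicFinDiag_toMonoidHom i v

/-- `ω(μ, ε, χ)` is irreducible at `restOfChar`, from Lemma D.1 (1) AS PRINTED at the `μ`-attached local data in the display frame (`hD1`;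
`V.adelicFinDiag` is onto, `n = 3 · 1`). [cite: Liu2021, Def. 4.11 (FJcycle.tex l. 2090–2096), App. D Lemma D.1 (l. 5227; (1) l. 5229)] -/
theorem rhoAt_restOfChar_isIrreducible_of_lemD1AsPrinted (h : exists_recordSystem) (F : CMField) [IsGalois ℚ F] (h6 : 6 ≤ Module.finrank ℚ F)
    (ι₁ : F →+* ℂ) (V : HermSpace3 F ι₁) (Φ : CMType F) (μ : IdeleClassGroup F →ₜ* Circle)
    (hμ : IdeleClassGroup.IsConjugateSymplectic F μ) (hw : IdeleClassGroup.HasWeight F μ 1)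
    (i : (toThm418Data (sec42DataOf h isoOf F ι₁ V Φ) (restOfChar h F h6 ι₁ V Φ μ hμ hw)).AdmIndex)
    (hD1 : ∀ v : HeightOneSpectrum (𝓞 ↥(maximalRealSubfield F)), LemD1_1AsPrinted
      (Def411WeilCarriers.localLemD1Data ↥(maximalRealSubfield F) F (IsCMField.complexConj F) 3 finProdFinEquiv (Matrix.diagonal V.diagEntries)
        (complexConj_imagUnit F) (imagUnit_ne_zero F) (imagUnit_mul_self F) (realDiagonal_isSymm F V.diagEntries V.complexConj_diagEntries)
        (isUnit_det_realDiagonal F V.diagEntries V.complexConj_diagEntries V.diagEntries_ne_zero)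
        (realDiagonal_map F V.diagEntries V.complexConj_diagEntries).symm (lineOf ↥(maximalRealSubfield F) (imagUnitSq F) i.1.1)
        (OmegaChiSplitting.chiLocalSplittings F ι₁ V (toHeckeCharacter F μ) ((isOscillatorChar_toHeckeCharacter_iff μ).mpr hμ)
          (lineOf ↥(maximalRealSubfield F) (imagUnitSq F) i.1.1))
        (le_of_eq (Nat.mul_one 3).symm) (localMu F (toHeckeCharacter F μ))
        (fun v x => norm_localMu F (toHeckeCharacter F μ) v (isUnitary_toHeckeCharacter F μ) x)
        (continuous_localMu F (toHeckeCharacter F μ))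
        (fun v t => localMu_toLocalRing_eq_one_iff F (toHeckeCharacter F μ) v ((isOscillatorChar_toHeckeCharacter_iff μ).mpr hμ) t)
        i.1.2.1
        (Def411WeilCarriers.norm_chi_eq_one ↥(maximalRealSubfield F) F (IsCMField.complexConj F)
          (Algebra.IsQuadraticExtension.finrank_eq_two ↥(maximalRealSubfield F) F)
          (UnitaryGroup.algEquiv_ne_one_of_apply_eq_neg ↥(maximalRealSubfield F) F (IsCMField.complexConj F) (complexConj_imagUnit F)
            (imagUnit_ne_zero F)) i.1.2)
        i.1.2.2.1 v)) :
    ((toThm418Data (sec42DataOf h isoOf F ι₁ V Φ) (restOfChar h F h6 ι₁ V Φ μ hμ hw)).rhoAt i).IsIrreducible :=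
  rhoAt_restOfCharD_isIrreducible_of_lemD1AsPrinted h F h6 ι₁ V Φ _ _ _ _ _ μ hμ hw
    (fun g => V.adelicFinDiag.toMulEquiv.surjective g) (le_of_eq (Nat.mul_one 3).symm) i hD1

end Display

end Summit.HodgeConjecture.CorCM.Model

end
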